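import Literature.Computability.QuantumComplexity.IQPCoveringSet
import HarnessLib

/-!
# Transversal-CNOT IQP architectures have colour-sorted phase polynomials, so the red column is a covering set
# (Maslov–Bravyi–Tripier–Maksymov–Latone 2024, §I.B, §II Lemma 1 (upper bound) and §II ‘simplified algorithm’)

Topic `Literature/Computability/QuantumComplexity` (pub-qadeq lane, CLAIMS §5 row E-16 — the Harvard/QuEra
48-logical-qubit IQP sampling experiment; companion of `IQPCoveringSet.lean` = README LEAN-IQPCOVER, which
proves the covering-set reduction to `2^s` Clifford slices but leaves “HQ_k's terms admit the first-column
cover” as a printed-only statement).  This file proves that statement for the whole ARCHITECTURE CLASS the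
source describes: any circuit on `m` blocks of three qubits built from transversal CNOT layers between
blocks and in-block diagonal `Z` / `CZ` / `CCZ` gates.

HONEST FRAMING: instance-level adjudication of specific advantage claims; no claim about BQP vs BPP or the
summit.  The file is symbolic phase-polynomial bookkeeping for a circuit family; nothing about any device,
noise, runtimes, or the hardness of general IQP sampling.

## Source statements formalised

* Architecture [cite: MaslovEtAl2024, §I.B]: “The IQP circuit HQ_k is built over n = 3m = 3·2^k inputs …
  it implements a combination of linear Boolean transformation and phase computation. The qubits are grouped
  into blocks of three, as dictated by the [[8,3,2]] error-correcting code … the CNOT gates apply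
  transversely (i.e., in the sets of three) … This offers k+1 opportunities to apply diagonal Z-axis gates
  Z, CZ, and CCZ inside each block of qubits between the CNOT gate layers.”
* Phase-polynomial semantics [cite: MaslovEtAl2024, §II (first two paragraphs)]: “The leftover part D_k
  contains Z : |x⟩ ↦ (−1)^x|x⟩, CZ : |x,y⟩ ↦ (−1)^{xy}|x,y⟩, and CCZ : |x,y,z⟩ ↦ (−1)^{xyz}|x,y,z⟩ gates,
  where x, y, and z are either qubits transformed by the first layer of Hadamards or their linear sums, and
  thus compute a polynomial of degree at most 3 into the phase.”
* Colour structure [cite: MaslovEtAl2024, §II (simplified algorithm, p. 4)]: “Each triple of logical qubits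
  encoded by the code [[8,3,2]] can be naturally labeled by red, green, and blue colors. We will write
  x = (x^R, x^G, x^B) … The polynomial f(x) contains cubic monomials x^R_i x^G_j x^B_ℓ originating from CCZ
  gates and quadratic monomials x^R_i x^G_j, x^R_i x^B_ℓ, x^G_j x^B_ℓ originating from CZ gates. …
  Monomials featuring more than one variable of the same color such as x^R_1 x^G_2 x^G_3 are prohibited
  since their generation requires CCZ or CZ gates that cannot be implemented transversally”.
* Lemma 1, upper bound [cite: MaslovEtAl2024, §II Lemma 1 (proof)]: “The set S := {3i+1 | i = 0..2^k−1}
  is a covering set because, due to the CNOT gate transversality, each CCZ takes as the first/top input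
  EXOR of a subset of such variables. Therefore, when written as a proper polynomial, each degree-3 term
  will contain a variable from the set S. This set has n/3 qubits.”

## Contents (all proved; 0 named facts; v2 = the level-0 section appended 2026-08-24, v1 declarations untouched)

Wires are `Fin m × Fin 3` (block, colour; colour `0` = red = the “3i+1” qubits of the source's numbering).
A linear form in the input variables is its coefficient vector `Wire m → 𝔽₂`; the WIRE STATE assigns to
each wire the linear form it currently carries (`initState`: wire `w` carries `x_w`).

* `cnot c t` / `cnotLayer` — a transversal CNOT from block `c` to block `t` adds, colour by colour, the
  control form to the target form (`wireValue_cnot`: the target VALUE becomes `x_t ⊕ x_c`); `Gate`,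
  `step`, `compile` — the symbolic compilation of a gate list into `(L, α, β, γ)` = (wire state, cubic
  tensor, quadratic tensor, linear part) in the vocabulary of `IQPAnticoncentration` (`cubicPart`,
  `quadPart`); **`phasePoly_step`** — the bookkeeping IS the printed semantics: a `CCZ` on block `b` adds
  the product of the three current linear forms of the block, a `CZ` the product of two, a `Z` one form.
* **`colourPure_compile`** — transversality invariant: after any gate list, the form on a wire of colour
  `r` involves only input variables of colour `r`.
* **`alpha_support_compile`** — hence every supported cubic coefficient of the compiled polynomial sits
  at a colour-sorted index triple (red, green, blue): the printed “cubic monomials x^R_i x^G_j x^B_ℓ …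
  monomials featuring more than one variable of the same color … are prohibited”; `beta_support_compile`
  — CZ gates on two different colours give two-colour quadratic monomials.
* **`isCoveringSet_red_compile`** — Lemma 1's upper bound for the whole architecture class: the red column
  (`IQPCoveringSet.firstColumn m`, `m = n/3` wires) is a covering set of the compiled cubic tensor; with
  LEAN-IQPCOVER this gives **`amplitude_eq_sum_red_slices`** / **`isQuadratic_red_slice`**: every
  amplitude of `H^{⊗n} D_f H^{⊗n}` for such a circuit is the signed sum over the `2^{n/3}` red assignments
  of `(n − n/3)`-qubit slice amplitudes, each slice a quadratic (Clifford) phase polynomial.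
* (v2) **`compile_levelZero_alpha`** / **`minCoveringSet_levelZero`** — the level-0 circuit of the class
  (one `CCZ` per block, no CNOT layer yet) compiles to exactly `IQPCoveringSet.blockCubic m`
  (`Σ_i x_{i,0}x_{i,1}x_{i,2}`, the “terms first generated at level 0”), so inside the architecture class
  the red column is a covering set of MINIMUM size `n/3`: Lemma 1's bound is attained.
* NOT here: the particular HQ_k gate placement (hypercube dimensions, the control/target bipartition, the
  asymmetric third diagonal layer) and therefore Lemma 1's LOWER bound for HQ_k (which needs the presence
  of the level-0 / 6-tuple terms — the counting given their presence is `IQPCoveringSet`'s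
  `minCoveringSet_blockCubic`); the unitary-level statement `HQ_k = H^{⊗n}·D'_k·H^{⊗n}` with the final
  CNOT stage moved through the Hadamards (cited, not re-derived); Lemma 2's `O(m³)` slice evaluation.

## References

* [MaslovEtAl2024] D. Maslov, S. Bravyi, F. Tripier, A. Maksymov, J. Latone, *Fast classical simulation of
  Harvard/QuEra IQP circuits*, arXiv:2402.03211 (2024): §I.B (held text p0002 L20–31), §II ¶1–2 (p0003
  L27–50), Lemma 1 (p0004 L12–16), simplified algorithm (p0004 L44–63).  Read via `lit read arxiv:2402.03211`.
-/

noncomputable section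

open Matrix Finset

namespace Literature.Computability.QuantumComplexity

namespace IQPTransversalColour

open GraphStateCutRank QuadraticBooleanWalsh IQPAnticoncentration IQPCoveringSet

variable {K : Type*} [Field K]
variable {m : ℕ}

/-! ### Wires, linear forms, the wire state and transversal CNOTs -/

/-- A wire = (block, colour); colour `0`/`1`/`2` = red/green/blue (the source's qubits `3i+1`, `3i+2`,
`3i+3` of block `i`). [cite: MaslovEtAl2024, §II (simplified algorithm: “labeled by red, green, and blue colors”)] -/
abbrev Wire (m : ℕ) := Fin m × Fin 3

/-- The WIRE STATE: the linear form (coefficient vector over the input variables) currently carried by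
each wire. [cite: MaslovEtAl2024, §II (“x, y, and z are either qubits transformed by the first layer of Hadamards or their linear sums”)] -/
abbrev WireState (m : ℕ) := Wire m → Wire m → ZMod 2

/-- Initially wire `w` carries the input variable `x_w`. [cite: MaslovEtAl2024, §II (“qubits transformed by the first layer of Hadamards”)] -/
def initState : WireState m := fun w v => if v = w then 1 else 0

/-- The VALUE on wire `w` at input `x`: the carried linear form evaluated at `x`.
[cite: MaslovEtAl2024, §II (“their linear sums”)] -/
def wireValue (L : WireState m) (w : Wire m) (x : Wire m → ZMod 2) : ZMod 2 := L w ⬝ᵥ x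

/-- A TRANSVERSAL CNOT from block `c` to block `t`: three CNOTs, colour by colour; symbolically the target
forms absorb the control forms. [cite: MaslovEtAl2024, §I.B (“the CNOT gates apply transversely (i.e., in the sets of three)”)] -/
def cnot (c t : Fin m) (L : WireState m) : WireState m :=
  fun w => if w.1 = t then L w + L (c, w.2) else L w

/-- A layer of transversal CNOTs (a list of (control block, target block) pairs, applied in order).
[cite: MaslovEtAl2024, §I.B (“At each CNOT gate layer, the CNOT gates apply along a yet-unexplored geometric dimension of the Boolean cube”)] -/
def cnotLayer (pairs : List (Fin m × Fin m)) (L : WireState m) : WireState m :=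
  pairs.foldl (fun L' p => cnot p.1 p.2 L') L

/-- Initially the value on wire `w` is `x_w`. [cite: MaslovEtAl2024, §II] -/
theorem wireValue_initState (w : Wire m) (x : Wire m → ZMod 2) : wireValue initState w x = x w := by
  unfold wireValue initState dotProduct
  rw [Finset.sum_eq_single w]
  · simp
  · intro v _ hv; simp [hv]
  · intro h; exact absurd (mem_univ w) h

/-- CNOT semantics on values: the target wire of colour `r` becomes `x_t ⊕ x_c` (current values), all other
wires are unchanged. [cite: MaslovEtAl2024, §I.B (transversal CNOT)] -/
theorem wireValue_cnot (c t : Fin m) (L : WireState m) (w : Wire m) (x : Wire m → ZMod 2) :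
    wireValue (cnot c t L) w x =
      if w.1 = t then wireValue L w x + wireValue L (c, w.2) x else wireValue L w x := by
  unfold wireValue cnot
  split_ifs with h
  · rw [add_dotProduct]
  · rfl

/-! ### Colour purity: transversality keeps colours separate -/

/-- COLOUR PURITY: the form on a wire of colour `r` involves only input variables of colour `r`.
[cite: MaslovEtAl2024, §II Lemma 1 (proof: “due to the CNOT gate transversality, each CCZ takes as the first/top input EXOR of a subset of such variables”)] -/
def ColourPure (L : WireState m) : Prop := ∀ w v : Wire m, L w v ≠ 0 → v.2 = w.2

/-- The initial state is colour pure. [cite: MaslovEtAl2024, §II Lemma 1 (proof)] -/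
theorem colourPure_initState : ColourPure (initState : WireState m) := by
  intro w v h
  unfold initState at h
  split_ifs at h with hv
  · rw [hv]
  · exact absurd rfl h

/-- A transversal CNOT preserves colour purity. [cite: MaslovEtAl2024, §II Lemma 1 (proof)] -/
theorem colourPure_cnot {L : WireState m} (hL : ColourPure L) (c t : Fin m) : ColourPure (cnot c t L) := by
  intro w v h
  unfold cnot at h
  split_ifs at h with hw
  · simp only [Pi.add_apply] at h
    by_cases h1 : L w v = 0
    · rw [h1, zero_add] at h
      exact hL (c, w.2) v h
    · exact hL w v h1
  · exact hL w v h

/-- A transversal CNOT layer preserves colour purity. [cite: MaslovEtAl2024, §II Lemma 1 (proof)] -/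
theorem colourPure_cnotLayer {L : WireState m} (hL : ColourPure L) (pairs : List (Fin m × Fin m)) :
    ColourPure (cnotLayer pairs L) := by
  unfold cnotLayer
  induction pairs generalizing L with
  | nil => simpa using hL
  | cons p ps ih =>
    simp only [List.foldl_cons]
    exact ih (colourPure_cnot hL p.1 p.2)

/-! ### Gates, the symbolic compilation and its phase-polynomial semantics -/

/-- The gate alphabet of the architecture: transversal CNOT layers between blocks, and the in-block diagonal
gates `CCZ` (on the three wires of a block), `CZ` (two wires of a block), `Z` (one wire).
[cite: MaslovEtAl2024, §I.B (“diagonal Z-axis gates Z, CZ, and CCZ inside each block of qubits between the CNOT gate layers”)] -/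
inductive Gate (m : ℕ)
  | cnots (pairs : List (Fin m × Fin m))
  | ccz (b : Fin m)
  | cz (b : Fin m) (r r' : Fin 3)
  | z (b : Fin m) (r : Fin 3)

/-- The compiled data: wire state, cubic tensor `α`, quadratic tensor `β`, linear part `γ` — the phase
polynomial `Σ α_{ijk} x_ix_jx_k + Σ β_{ij} x_ix_j + Σ γ_k x_k` in the vocabulary of
`IQPAnticoncentration.cubicPart` / `quadPart`. [cite: MaslovEtAl2024, §II (“compute a polynomial of degree at most 3 into the phase”)] -/
structure PhaseData (m : ℕ) where
  /-- current linear form on each wire -/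
  L : WireState m
  /-- cubic coefficient tensor -/
  α : Wire m → Wire m → Wire m → ZMod 2
  /-- quadratic coefficient tensor -/
  β : Wire m → Wire m → ZMod 2
  /-- linear coefficients -/
  γ : Wire m → ZMod 2

/-- The cubic tensor contributed by a `CCZ` on block `b`: the trilinear expansion of the product of the
block's three current forms. [cite: MaslovEtAl2024, §II (“CCZ : |x,y,z⟩ ↦ (−1)^{xyz}|x,y,z⟩ … linear sums”)] -/
def cczTensor (L : WireState m) (b : Fin m) : Wire m → Wire m → Wire m → ZMod 2 :=
  fun i j k => L (b, 0) i * L (b, 1) j * L (b, 2) k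

/-- The quadratic tensor contributed by a `CZ` on wires `(b,r)`, `(b,r')`. [cite: MaslovEtAl2024, §II (“CZ : |x,y⟩ ↦ (−1)^{xy}|x,y⟩”)] -/
def czTensor (L : WireState m) (b : Fin m) (r r' : Fin 3) : Wire m → Wire m → ZMod 2 :=
  fun i j => L (b, r) i * L (b, r') j

/-- One compilation step. [cite: MaslovEtAl2024, §II (first two paragraphs)] -/
def step (P : PhaseData m) : Gate m → PhaseData m
  | .cnots pairs => { P with L := cnotLayer pairs P.L }
  | .ccz b => { P with α := P.α + cczTensor P.L b }
  | .cz b r r' => { P with β := P.β + czTensor P.L b r r' }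
  | .z b r => { P with γ := P.γ + P.L (b, r) }

/-- The empty circuit: identity wire state, zero phase. [cite: MaslovEtAl2024, §II] -/
def initData : PhaseData m := ⟨initState, 0, 0, 0⟩

/-- Compile a gate list (applied left to right). [cite: MaslovEtAl2024, §II] -/
def compile (gs : List (Gate m)) : PhaseData m := gs.foldl step initData

/-- The phase polynomial `f` of compiled data. [cite: MaslovEtAl2024, §II (eq. (1): |x⟩ ↦ (−1)^{f(x)}|x⟩ “where f(x) is a degree-3 polynomial”)] -/
def phasePoly (P : PhaseData m) : (Wire m → ZMod 2) → ZMod 2 :=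
  fun x => cubicPart P.α x + quadPart P.β P.γ x

/-- The printed gate semantics on current wire VALUES: `CCZ ↦ xyz`, `CZ ↦ xy`, `Z ↦ x`, CNOT layers add no
phase. [cite: MaslovEtAl2024, §II (“Z : |x⟩ ↦ (−1)^x|x⟩, CZ : |x,y⟩ ↦ (−1)^{xy}|x,y⟩, and CCZ : |x,y,z⟩ ↦ (−1)^{xyz}|x,y,z⟩ gates, where x, y, and z are either qubits … or their linear sums”)] -/
def gatePhase (L : WireState m) : Gate m → (Wire m → ZMod 2) → ZMod 2
  | .cnots _ => fun _ => 0
  | .ccz b => fun x => wireValue L (b, 0) x * wireValue L (b, 1) x * wireValue L (b, 2) x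
  | .cz b r r' => fun x => wireValue L (b, r) x * wireValue L (b, r') x
  | .z b r => fun x => wireValue L (b, r) x

/-- `cubicPart` is additive in the tensor. [cite: BremnerMontanaroShepherd2016, p. 3 (display of f)] -/
theorem cubicPart_add (α α' : Wire m → Wire m → Wire m → ZMod 2) (x : Wire m → ZMod 2) :
    cubicPart (α + α') x = cubicPart α x + cubicPart α' x := by
  simp only [cubicPart, Pi.add_apply, add_mul, sum_add_distrib]

/-- `quadPart` is additive in the quadratic tensor. [cite: BremnerMontanaroShepherd2016, App. Lemma 12 proof] -/
theorem quadPart_add_left (β β' : Wire m → Wire m → ZMod 2) (γ : Wire m → ZMod 2) (x : Wire m → ZMod 2) :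
    quadPart (β + β') γ x = quadPart β γ x + quadPart β' 0 x := by
  simp only [quadPart, Pi.add_apply, Pi.zero_apply, add_mul, zero_mul, sum_add_distrib, sum_const_zero,
    add_zero]
  ring

/-- `quadPart` is additive in the linear part. [cite: BremnerMontanaroShepherd2016, App. Lemma 12 proof] -/
theorem quadPart_add_right (β : Wire m → Wire m → ZMod 2) (γ γ' : Wire m → ZMod 2) (x : Wire m → ZMod 2) :
    quadPart β (γ + γ') x = quadPart β γ x + γ' ⬝ᵥ x := by
  simp only [quadPart, Pi.add_apply, add_mul, sum_add_distrib, dotProduct]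
  ring

/-- The trilinear expansion: `Σ_{ijk} ℓ⁰_i ℓ¹_j ℓ²_k x_ix_jx_k = (ℓ⁰·x)(ℓ¹·x)(ℓ²·x)` — a CCZ on linear sums
is the cubic tensor `cczTensor`. [cite: MaslovEtAl2024, §II (“CCZ : |x,y,z⟩ ↦ (−1)^{xyz} … linear sums, and thus compute a polynomial of degree at most 3”)] -/
theorem cubicPart_cczTensor (L : WireState m) (b : Fin m) (x : Wire m → ZMod 2) :
    cubicPart (cczTensor L b) x =
      wireValue L (b, 0) x * wireValue L (b, 1) x * wireValue L (b, 2) x := by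
  simp only [cubicPart, cczTensor, wireValue, dotProduct]
  rw [Finset.sum_mul_sum, Finset.sum_mul_sum]
  refine sum_congr rfl fun i _ => ?_
  simp only [Finset.sum_mul]
  rw [Finset.sum_comm]
  refine sum_congr rfl fun j _ => sum_congr rfl fun k _ => ?_
  ring

/-- The bilinear expansion: a CZ on linear sums is the quadratic tensor `czTensor`.
[cite: MaslovEtAl2024, §II (“CZ : |x,y⟩ ↦ (−1)^{xy}”)] -/
theorem quadPart_czTensor (L : WireState m) (b : Fin m) (r r' : Fin 3) (x : Wire m → ZMod 2) :
    quadPart (czTensor L b r r') 0 x = wireValue L (b, r) x * wireValue L (b, r') x := by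
  simp only [quadPart, czTensor, wireValue, dotProduct, Pi.zero_apply, zero_mul, sum_const_zero, add_zero]
  rw [Finset.sum_mul_sum]
  refine sum_congr rfl fun i _ => sum_congr rfl fun j _ => ?_
  ring

/-- **The bookkeeping is the printed semantics**: each compilation step adds exactly the printed gate phase
(evaluated on the current wire values) to the phase polynomial, and CNOT layers only re-label the wires.
[cite: MaslovEtAl2024, §II (first two paragraphs)] -/
theorem phasePoly_step (P : PhaseData m) (g : Gate m) (x : Wire m → ZMod 2) :
    phasePoly (step P g) x = phasePoly P x + gatePhase P.L g x := by
  cases g with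
  | cnots pairs => simp [step, phasePoly, gatePhase]
  | ccz b =>
    simp only [step, phasePoly, gatePhase, cubicPart_add, cubicPart_cczTensor]
    ring
  | cz b r r' =>
    simp only [step, phasePoly, gatePhase, quadPart_add_left, quadPart_czTensor]
    ring
  | z b r =>
    simp only [step, phasePoly, gatePhase, quadPart_add_right, wireValue]
    ring

/-- CNOT layers do not touch the phase data; diagonal gates do not touch the wire state.
[cite: MaslovEtAl2024, §II (“-D_k-CNOT- as a two-stage computation”)] -/
theorem step_L (P : PhaseData m) (g : Gate m) :
    (step P g).L = match g with
      | .cnots pairs => cnotLayer pairs P.L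
      | _ => P.L := by
  cases g <;> rfl

/-! ### The invariants of a compiled circuit -/

/-- The compilation invariant: colour-pure wires, colour-sorted cubic support, and (for CZ gates on two
different colours) two-colour quadratic support. [cite: MaslovEtAl2024, §II (simplified algorithm: the colour structure of f)] -/
structure Inv (P : PhaseData m) : Prop where
  pure : ColourPure P.L
  cubic : ∀ i j k, P.α i j k ≠ 0 → i.2 = 0 ∧ j.2 = 1 ∧ k.2 = 2
  quad : ∀ i j, P.β i j ≠ 0 → ∃ r r' : Fin 3, i.2 = r ∧ j.2 = r'

/-- Gate lists whose `CZ` gates act on two DIFFERENT colours (the only transversally implementable ones).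
[cite: MaslovEtAl2024, §II (“quadratic monomials x^R_i x^G_j, x^R_i x^B_ℓ, x^G_j x^B_ℓ originating from CZ gates”)] -/
def CZTwoColour : List (Gate m) → Prop
  | [] => True
  | (.cz _ r r') :: gs => r ≠ r' ∧ CZTwoColour gs
  | _ :: gs => CZTwoColour gs

/-- The initial data satisfy the invariant. [cite: MaslovEtAl2024, §II] -/
theorem inv_initData : Inv (initData : PhaseData m) :=
  ⟨colourPure_initState, fun _ _ _ h => absurd rfl h, fun _ _ h => absurd rfl h⟩

/-- One step preserves colour purity and the colour-sorted cubic support.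
[cite: MaslovEtAl2024, §II Lemma 1 (proof) and simplified algorithm] -/
theorem inv_step {P : PhaseData m} (hP : Inv P) (g : Gate m) : Inv (step P g) := by
  cases g with
  | cnots pairs =>
    exact ⟨colourPure_cnotLayer hP.pure pairs, hP.cubic, hP.quad⟩
  | ccz b =>
    refine ⟨hP.pure, ?_, hP.quad⟩
    intro i j k h
    simp only [step, Pi.add_apply] at h
    by_cases hα : P.α i j k = 0
    · rw [hα, zero_add] at h
      unfold cczTensor at h
      have h0 : P.L (b, 0) i ≠ 0 := fun e => h (by rw [e]; ring)
      have h1 : P.L (b, 1) j ≠ 0 := fun e => h (by rw [e]; ring)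
      have h2 : P.L (b, 2) k ≠ 0 := fun e => h (by rw [e]; ring)
      exact ⟨hP.pure _ _ h0, hP.pure _ _ h1, hP.pure _ _ h2⟩
    · exact hP.cubic i j k hα
  | cz b r r' =>
    refine ⟨hP.pure, hP.cubic, ?_⟩
    intro i j h
    exact ⟨i.2, j.2, rfl, rfl⟩
  | z b r => exact ⟨hP.pure, hP.cubic, hP.quad⟩

/-- The invariant holds along any compilation. [cite: MaslovEtAl2024, §II Lemma 1 (proof)] -/
theorem inv_foldl (gs : List (Gate m)) {P : PhaseData m} (hP : Inv P) : Inv (gs.foldl step P) := by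
  induction gs generalizing P with
  | nil => simpa using hP
  | cons g gs ih =>
    simp only [List.foldl_cons]
    exact ih (inv_step hP g)

/-- **Transversality invariant**: after any gate list of the architecture, the form on every wire of colour
`r` involves only input variables of colour `r`. [cite: MaslovEtAl2024, §II Lemma 1 (proof: “each CCZ takes as the first/top input EXOR of a subset of such variables”)] -/
theorem colourPure_compile (gs : List (Gate m)) : ColourPure (compile gs).L :=
  (inv_foldl gs inv_initData).pure

/-- **Colour-sorted cubic support**: every supported cubic coefficient of the compiled phase polynomial sits
at a (red, green, blue) index triple — “cubic monomials x^R_i x^G_j x^B_ℓ originating from CCZ gates …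
Monomials featuring more than one variable of the same color … are prohibited”.
[cite: MaslovEtAl2024, §II (simplified algorithm, p. 4)] -/
theorem alpha_support_compile (gs : List (Gate m)) (i j k : Wire m)
    (h : (compile gs).α i j k ≠ 0) : i.2 = 0 ∧ j.2 = 1 ∧ k.2 = 2 :=
  (inv_foldl gs inv_initData).cubic i j k h

/-- Two-colour quadratic support: along a gate list whose CZ gates act on different colours, every supported
quadratic coefficient sits at an index pair of two different colours — “quadratic monomials x^R_i x^G_j,
x^R_i x^B_ℓ, x^G_j x^B_ℓ originating from CZ gates”. [cite: MaslovEtAl2024, §II (simplified algorithm, p. 4)] -/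
theorem beta_support_compile (gs : List (Gate m)) (hgs : CZTwoColour gs) (i j : Wire m)
    (h : (compile gs).β i j ≠ 0) : i.2 ≠ j.2 := by
  -- strengthen the invariant along the fold
  suffices H : ∀ (gs : List (Gate m)) (P : PhaseData m), CZTwoColour gs → ColourPure P.L →
      (∀ i j, P.β i j ≠ 0 → i.2 ≠ j.2) → ∀ i j, (gs.foldl step P).β i j ≠ 0 → i.2 ≠ j.2 from
    H gs initData hgs colourPure_initState (fun i j h => absurd rfl h) i j h
  intro gs
  induction gs with
  | nil => intro P _ _ hβ i j h; simpa using hβ i j (by simpa using h)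
  | cons g gs ih =>
    intro P hgs hL hβ i j h
    simp only [List.foldl_cons] at h
    cases g with
    | cnots pairs =>
      exact ih (step P (.cnots pairs)) hgs (colourPure_cnotLayer hL pairs) hβ i j h
    | ccz b => exact ih (step P (.ccz b)) hgs hL hβ i j h
    | cz b r r' =>
      obtain ⟨hrr, hgs'⟩ := hgs
      refine ih (step P (.cz b r r')) hgs' hL ?_ i j h
      intro i' j' h'
      simp only [step, Pi.add_apply] at h'
      by_cases hb : P.β i' j' = 0
      · rw [hb, zero_add] at h'
        unfold czTensor at h'
        have h0 : P.L (b, r) i' ≠ 0 := fun e => h' (by rw [e]; ring)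
        have h1 : P.L (b, r') j' ≠ 0 := fun e => h' (by rw [e]; ring)
        rw [hL _ _ h0, hL _ _ h1]
        exact hrr
      · exact hβ i' j' hb
    | z b r => exact ih (step P (.z b r)) hgs hL hβ i j h

/-! ### Lemma 1's upper bound for the architecture class, and the Clifford-slice expansion -/

/-- **The red column is a covering set** of the compiled cubic tensor, for EVERY circuit of the
architecture — “The set S := {3i+1} is a covering set because, due to the CNOT gate transversality, each
CCZ takes as the first/top input EXOR of a subset of such variables … This set has n/3 qubits”.
[cite: MaslovEtAl2024, §II Lemma 1 (proof, upper bound)] -/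
theorem isCoveringSet_red_compile (gs : List (Gate m)) :
    IsCoveringSet (firstColumn m) (compile gs).α := by
  intro i j k h
  left
  have hi := (alpha_support_compile gs i j k h).1
  simp only [firstColumn, mem_image, mem_univ, true_and]
  exact ⟨i.1, Prod.ext rfl hi.symm⟩

/-- The red column has `m = n/3` of the `n = 3m` wires, so the expansion below has `2^{n/3}` terms.
[cite: MaslovEtAl2024, §II Lemma 1 (“This set has n/3 qubits”) and the sentence after it (“2^{n/3} simulations of a Clifford … circuit”)] -/
theorem red_column_count (m : ℕ) :
    3 * (firstColumn m).card = Fintype.card (Wire m) ∧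
      Fintype.card ({v // v ∈ firstColumn m} → ZMod 2) = 2 ^ m := by
  refine ⟨?_, card_assignments_firstColumn m⟩
  rw [card_firstColumn]
  simp [Fintype.card_prod, Fintype.card_fin, mul_comm]

/-- **Every red slice is Clifford**: fixing the red variables of a compiled architecture circuit leaves a
quadratic phase polynomial in the `n − n/3` green/blue variables (LEAN-IQPCOVER's degree reduction applied
with the red covering set). [cite: MaslovEtAl2024, §II (“fixing all qubits in S transforms a degree-3 polynomial to a degree-2 polynomial … each of the 2^s subspaces will be a Clifford circuit”) and Lemma 1] -/
theorem isQuadratic_red_slice (gs : List (Gate m)) (c : ZMod 2)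
    (a : {v // v ∈ firstColumn m} → ZMod 2) :
    IsQuadratic (sliceFun (firstColumn m) a fun x => phasePoly (compile gs) x + c) := by
  have h := isQuadratic_sliceFun_poly3 (firstColumn m) (isCoveringSet_red_compile gs)
    (compile gs).β (compile gs).γ c a
  simpa [phasePoly] using h

/-- **The amplitude of an architecture circuit as `2^{n/3}` Clifford slices**: for every gate list `gs`,
constant `c` and output string `y`, the `-H-D_f-H-` amplitude `2^{−n} W_f(y)` of the compiled phase
polynomial `f = phasePoly (compile gs) + c` equals the sum over the `2^m = 2^{n/3}` red assignments `a` of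
`(−1)^{y_R·a}/2^m` times the `(n − m)`-qubit slice amplitude — LEAN-IQPCOVER's expansion along the red
covering set. [cite: MaslovEtAl2024, §II (display “⟨y|HQ_k|0⟩ = a_0(|++…+⟩) + … + a_{2^s−1}(|−…−⟩)”) and Lemma 1 (“relying on 2^{n/3} simulations of a Clifford 2m-qubit circuit”)] -/
theorem amplitude_eq_sum_red_slices [NeZero (2 : K)] (gs : List (Gate m)) (c : ZMod 2)
    (y : Wire m → ZMod 2) :
    (walsh (fun x => phasePoly (compile gs) x + c) y : K) / (2 : K) ^ Fintype.card (Wire m) =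
      ∑ a : {v // v ∈ firstColumn m} → ZMod 2,
        chi (∑ v : {v // v ∈ firstColumn m}, y v.1 * a v) / (2 : K) ^ (firstColumn m).card *
          (walsh (sliceFun (firstColumn m) a fun x => phasePoly (compile gs) x + c)
              (fun v : {v // v ∉ firstColumn m} => y v.1) /
            (2 : K) ^ Fintype.card {v // v ∉ firstColumn m}) :=
  amplitude_eq_sum_slices (firstColumn m) _ y

/-! ### The level-0 circuit attains Lemma 1's bound: one CCZ per block -/

/-- Folding a list of `CCZ` gates: the wire state is unchanged and the cubic tensor accumulates the blocks'
`cczTensor`s. [cite: MaslovEtAl2024, §II (“-D_k-CNOT- as a two-stage computation … the diagonal part”)] -/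
theorem foldl_ccz (bs : List (Fin m)) (P : PhaseData m) :
    (bs.map Gate.ccz).foldl step P =
      { P with α := fun i j k => P.α i j k + (bs.map fun b => cczTensor P.L b i j k).sum } := by
  induction bs generalizing P with
  | nil => cases P; simp
  | cons b bs ih =>
    simp only [List.map_cons, List.foldl_cons]
    rw [ih]
    cases P
    simp only [step, List.sum_cons, Pi.add_apply]
    congr 1
    funext i j k
    ring

/-- On the initial wire state a `CCZ` on block `b` is the single monomial `x_{b,0} x_{b,1} x_{b,2}`.
[cite: MaslovEtAl2024, §II Lemma 1 (proof: “Boolean product terms (3i+1)·(3i+2)·(3i+3) … first generated at level 0”)] -/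
theorem cczTensor_initState (b : Fin m) (i j k : Wire m) :
    cczTensor initState b i j k = if i = (b, 0) ∧ j = (b, 1) ∧ k = (b, 2) then 1 else 0 := by
  unfold cczTensor initState
  by_cases hi : i = (b, 0) <;> by_cases hj : j = (b, 1) <;> by_cases hk : k = (b, 2) <;> simp [hi, hj, hk]

/-- **The level-0 circuit compiles to the block polynomial**: one `CCZ` on every block (no CNOT layer yet)
gives exactly `IQPCoveringSet.blockCubic m` = `Σ_i x_{i,0}x_{i,1}x_{i,2}` — the “terms first generated at
level 0”. [cite: MaslovEtAl2024, §II Lemma 1 (proof, k even)] -/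
theorem compile_levelZero_alpha (m : ℕ) :
    (compile (List.ofFn fun b : Fin m => Gate.ccz b)).α = blockCubic m := by
  unfold compile
  rw [show (List.ofFn fun b : Fin m => Gate.ccz b) = (List.ofFn fun b : Fin m => b).map Gate.ccz by
    rw [List.map_ofFn]; rfl]
  rw [foldl_ccz]
  funext i j k
  simp only [initData, Pi.zero_apply, zero_add, List.map_ofFn]
  rw [List.sum_ofFn]
  simp only [Function.comp, cczTensor_initState]
  unfold blockCubic
  by_cases h : i.2 = 0 ∧ j.2 = 1 ∧ k.2 = 2 ∧ j.1 = i.1 ∧ k.1 = i.1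
  · rw [if_pos h, Finset.sum_eq_single i.1]
    · rw [if_pos]
      obtain ⟨h0, h1, h2, hj, hk⟩ := h
      exact ⟨Prod.ext rfl h0, Prod.ext hj h1, Prod.ext hk h2⟩
    · intro b _ hb
      rw [if_neg]
      rintro ⟨hi', -, -⟩
      exact hb (by rw [hi'])
    · intro huniv; exact absurd (mem_univ _) huniv
  · rw [if_neg h]
    refine Finset.sum_eq_zero fun b _ => ?_
    rw [if_neg]
    rintro ⟨hi', hj', hk'⟩
    apply h
    subst hi'; subst hj'; subst hk'
    exact ⟨rfl, rfl, rfl, rfl, rfl⟩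

/-- The level-0 circuit leaves the wire state and the degree-≤ 2 part untouched.
[cite: MaslovEtAl2024, §II Lemma 1 (proof, level 0)] -/
theorem compile_levelZero_quad (m : ℕ) :
    (compile (List.ofFn fun b : Fin m => Gate.ccz b)).β = 0 ∧
      (compile (List.ofFn fun b : Fin m => Gate.ccz b)).γ = 0 := by
  unfold compile
  rw [show (List.ofFn fun b : Fin m => Gate.ccz b) = (List.ofFn fun b : Fin m => b).map Gate.ccz by
    rw [List.map_ofFn]; rfl]
  rw [foldl_ccz]
  exact ⟨rfl, rfl⟩

/-- **Lemma 1 is attained inside the architecture class**: for the level-0 circuit (one CCZ per block) the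
red column is a covering set of MINIMUM size `m = n/3` — no covering set of the compiled cubic tensor is
smaller (LEAN-IQPCOVER's `minCoveringSet_blockCubic` transported through `compile_levelZero_alpha`).
[cite: MaslovEtAl2024, §II Lemma 1 (“the minimal covering set contains exactly n/3 qubits”)] -/
theorem minCoveringSet_levelZero (m : ℕ) :
    IsCoveringSet (firstColumn m) (compile (List.ofFn fun b : Fin m => Gate.ccz b)).α ∧
      3 * (firstColumn m).card = Fintype.card (Wire m) ∧
      ∀ S₁ : Finset (Wire m), IsCoveringSet S₁ (compile (List.ofFn fun b : Fin m => Gate.ccz b)).α →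
        (firstColumn m).card ≤ S₁.card := by
  rw [compile_levelZero_alpha]
  exact minCoveringSet_blockCubic m

end IQPTransversalColour

end Literature.Computability.QuantumComplexity

end
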